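import Summits.QuantumFields.BalabanUV.Beta.SymCorrectorForms
import Summits.QuantumFields.BalabanUV.Beta.CompositeCorrectorKernelSpr
import Summits.QuantumFields.BalabanUV.Beta.AxialCoordinateProjectorCoarse

/-!
# `BalabanUV.Beta.SymCorrectorKernel` — binder row D1, PART 23 re-ruling (F-g22-1 ∕ Q-g22-1, leaf-03 g28 N-g28-1 «CHART-TRANSPORT»), brick TT2a:
# **THE ONE-STEP SYMMETRISED CORRECTORS KERNELISED** — `Ψ̂_S = psiKS r n := kerOf (Ψ_S)`, `Φ̂_S = phiKS r n := kerOf (Φ_S)` (root offset `r ∈ box`, `ρ = toSite r`;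
# for the chart of record `r = ctrOff (d+1) n`): the apply bridge, row-finiteness, finite range, block-translation covariance, SPREAD, MUTUAL INVERSE
# `Ψ̂_S ∘ Φ̂_S = idK = Φ̂_S ∘ Ψ̂_S`, and SLICE PRESERVATION `(axEc ∘ Ψ̂_S) ∘ axEc = Ψ̂_S ∘ axEc` for every in-block slice root — i.e. five of the six hypotheses of the
# row's socket `RelInvCompositeSocket.relInv_composite_of_corrector'` for the SYMMETRISED corrector pair (the sixth, the bordered identity `Φ̂_Sᵀ∘bhK∘Φ̂_S = bhK + Dsh`,
# and the END are TT2b `SymCorrectorTransport`).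

Decl-by-decl twin of leaf-06 g32's `CompositeCorrectorKernel` §3–§4, `CompositeCorrectorKernelSpr` §1∕§3 and leaf-09 g39's `CompositeCorrectorRules` with `(corrPsi r L m, corrPhi r L m, L^m) ↦
(corrPsiS (toSite r) n, corrPhiS (toSite r) n, n)`; the generic machinery (`kerOf`, `comp_kerOf_inl`, `apply_eq_sum_of_depOn`, `spr_of_blockShift_of_range`, `CorrReads ∕ corrDep`) is consumed BY NAME.
HONEST FRAMING (cell contract, verbatim): «discharging `BetaPertH` makes Bałaban's UV stability UNCONDITIONAL — a real constructive-QFT result; it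
is NOT the continuum limit and NOT the Clay problem.»  HONEST DEPENDENCY (verbatim): «continuum YM on T⁴ ⇐ BetaPertH ∧ nine spine estimates (0/9
proved); BetaPertH ⇐ (D1) ∧ (D4) ∧ CAP+tail; G-an2-4 gates asym, D1 and NE2/3/4.»
ABSOLUTE RULE (cell, verbatim): «No internally-minted statement may enter as a cited fact. Every hypothesis is either kernel-proved in this package or a
verbatim quotation of a PUBLISHED theorem with page reference. The manuscript(s) under audit are NOT citable for their own disputed steps — they are the
thing under adjudication; programme-internal (2001/route/tribunal) claims are never citable.»  NOTHING is cited; two DATA definitions ([our object] `psiKS`, `phiKS`) and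
[folklore] finite-sum kernel bookkeeping.  Discharges NOTHING of (K), of hW ∕ hR ∕ D1Tel ∕ D1Rep (0∕4), of D1 or of BetaPertH; NOT continuum, NOT Clay.

CONTENT ([folklore]; `d+1` the lattice dimension, `0 < n`, `r ∈ box (d+1) n`):
§1 [our objects] `psiKS`, `phiKS`; entry lemmas.  §2 `corrPsiS_apply_eq_sum ∕ corrPhiS_apply_eq_sum`, `psiKS_inl_inl_eq_zero ∕ phiKS_…`, `psiKS_eq_idK_of_blk_ne ∕ phiKS_…`,
the apply bridge `comp_psiKS_inl ∕ _inr`, `comp_trK_psiKS_inl ∕ _inr` (+ `phiKS` twins).  §3 `psiKS_shift ∕ phiKS_shift`, `shiftK_psiKS ∕ phiKS`, `decays_psiKS ∕ phiKS`,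
**`spr_psiKS ∕ spr_phiKS`** (+ `trK`).  §4 **`comp_psiKS_phiKS`**, **`comp_phiKS_psiKS`**.  §5 **`comp_comp_axEc_psiKS`**, **`comp_comp_axEc_phiKS`**.
Provenance: D1 formalisation swarm, unit `b2b-balaban-beta-d1-formalise-leaf-03` (gen 28), 2026-08-22; no existing file touched.
-/

namespace Summit.QuantumFields.BalabanUV.Beta.SymCorrectorKernel

open Finset
open scoped BigOperators
open Literature.Probability.LatticeModels (Torus.proj)
open Literature.MathematicalPhysics.QuantumFieldTheory
open Literature.MathematicalPhysics.QuantumFieldTheory.Balaban1983to89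
open Literature.MathematicalPhysics.QuantumFieldTheory.Balaban1983to89.Beta
open ExpKernelCalculus (MKer Decays comp shiftK)
open HessKerSchurResolvent (idK idK_apply)
open OneStepResolventKernel (Fib)
open AffineAveraging (Site Form1 box toSite unitVec)
open AveragingContours (blk)
open Summit.QuantumFields.BalabanUV.Beta.TameKernelCalculus (Spr trK)
open Summit.QuantumFields.BalabanUV.Beta.AxialDressingRooted (IsCombBondAt axEc comp_axEc_apply comp_axEc_apply')
open Summit.QuantumFields.BalabanUV.Beta.SymCorrectorForms (corrPhiS corrPsiS corrPsiS_corrPhiS corrPhiS_corrPsiS corrPsiS_sum_smul corrPhiS_sum_smul corrPsiS_zero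
  corrPhiS_zero corrPsiS_shift corrPhiS_shift corrPsiS_apply_of_blk_eq corrPhiS_apply_of_blk_eq depOn_corrPsiS depOn_corrPhiS)
open Summit.QuantumFields.BalabanUV.Beta.CompositeCorrectorLocality (DepOn CorrReads corrDep mem_corrDep_of_mem_corrReads)
open Summit.QuantumFields.BalabanUV.Beta.CompositeCorrectorKernel (indR indR_apply kerOf kerOf_inl_inl kerOf_inl_inr kerOf_inr_inl kerOf_inr_inr
  apply_eq_sum_of_depOn apply_indR_eq_zero_of_not_mem comp_kerOf_inl comp_kerOf_inr comp_trK_kerOf_inl comp_trK_kerOf_inr kerOf_shift kerBound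
  decays_of_blockShift_of_range)

noncomputable section

variable {d : ℕ}

/-! ## §1 The kernel correctors -/
/-- [our object] **`Ψ̂_S`** — the kernelised symmetrised dressing-side corrector `Ψ_S` (root `toSite r`, block side `n`): field block `(Ψ_S e_{(β,y)})_α(x)`, multiplier block
the identity, mixed blocks `0`. -/
def psiKS (r : Fin (d + 1) → ℕ) (n : ℕ) : MKer (d + 1) (Fib d) := kerOf (corrPsiS (toSite r) n)

/-- [our object] **`Φ̂_S`** — the kernelised symmetrised border-side corrector `Φ_S`. -/
def phiKS (r : Fin (d + 1) → ℕ) (n : ℕ) : MKer (d + 1) (Fib d) := kerOf (corrPhiS (toSite r) n)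

section Entries

variable (r : Fin (d + 1) → ℕ) (n : ℕ) (x y : Site (d + 1))

/-- [folklore] `psiKS` field–field entry. -/
theorem psiKS_inl_inl (α β : Fin (d + 1)) : psiKS r n x y (Sum.inl α) (Sum.inl β) = corrPsiS (toSite r) n (indR β y) α x := rfl
/-- [folklore] `psiKS` field–multiplier entry vanishes. -/
theorem psiKS_inl_inr (α μ : Fin (d + 1)) : psiKS r n x y (Sum.inl α) (Sum.inr μ) = 0 := rfl
/-- [folklore] `psiKS` multiplier–field entry vanishes. -/
theorem psiKS_inr_inl (μ α : Fin (d + 1)) : psiKS r n x y (Sum.inr μ) (Sum.inl α) = 0 := rfl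
/-- [folklore] `psiKS` multiplier–multiplier entry is the identity. -/
theorem psiKS_inr_inr (μ μ' : Fin (d + 1)) : psiKS r n x y (Sum.inr μ) (Sum.inr μ') = if x = y ∧ μ = μ' then 1 else 0 := rfl
/-- [folklore] `phiKS` field–field entry. -/
theorem phiKS_inl_inl (α β : Fin (d + 1)) : phiKS r n x y (Sum.inl α) (Sum.inl β) = corrPhiS (toSite r) n (indR β y) α x := rfl
/-- [folklore] `phiKS` field–multiplier entry vanishes. -/
theorem phiKS_inl_inr (α μ : Fin (d + 1)) : phiKS r n x y (Sum.inl α) (Sum.inr μ) = 0 := rfl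
/-- [folklore] `phiKS` multiplier–field entry vanishes. -/
theorem phiKS_inr_inl (μ α : Fin (d + 1)) : phiKS r n x y (Sum.inr μ) (Sum.inl α) = 0 := rfl
/-- [folklore] `phiKS` multiplier–multiplier entry is the identity. -/
theorem phiKS_inr_inr (μ μ' : Fin (d + 1)) : phiKS r n x y (Sum.inr μ) (Sum.inr μ') = if x = y ∧ μ = μ' then 1 else 0 := rfl

end Entries

/-! ## §2 The apply bridge, row-finiteness, finite range -/

section Bridge

variable {n : ℕ} (hn : 0 < n) {r : Fin (d + 1) → ℕ} (hr : r ∈ box (d + 1) n)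
include hn hr

omit hr in
/-- [folklore] The read set of a corrector component is contained in the `Finset` `corrDep`. -/
theorem exists_finset_corrReadsS (α : Fin (d + 1)) (x : Site (d + 1)) :
    ∃ S : Finset (Fin (d + 1) × Site (d + 1)), ∀ p ∈ CorrReads n α x, p ∈ S :=
  ⟨corrDep n α x, fun _ hp => mem_corrDep_of_mem_corrReads hn hp⟩

/-- [folklore] **FINITE EXPANSION OF `Ψ_S`**: `(Ψ_S A)_α(x) = Σ_{p ∈ S} (Ψ_S e_p)_α(x) · A_p` for every `Finset` `S ⊇ CorrReads n α x`. -/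
theorem corrPsiS_apply_eq_sum (α : Fin (d + 1)) (x : Site (d + 1)) {S : Finset (Fin (d + 1) × Site (d + 1))}
    (hS : ∀ p ∈ CorrReads n α x, p ∈ S) (A : Form1 (d + 1) ℝ) :
    corrPsiS (toSite r) n A α x = ∑ p ∈ S, corrPsiS (toSite r) n (indR p.1 p.2) α x * A p.1 p.2 :=
  apply_eq_sum_of_depOn (depOn_corrPsiS hn hr α x) hS (corrPsiS_sum_smul (toSite r) n) A

/-- [folklore] **FINITE EXPANSION OF `Φ_S`.** -/
theorem corrPhiS_apply_eq_sum (α : Fin (d + 1)) (x : Site (d + 1)) {S : Finset (Fin (d + 1) × Site (d + 1))}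
    (hS : ∀ p ∈ CorrReads n α x, p ∈ S) (A : Form1 (d + 1) ℝ) :
    corrPhiS (toSite r) n A α x = ∑ p ∈ S, corrPhiS (toSite r) n (indR p.1 p.2) α x * A p.1 p.2 :=
  apply_eq_sum_of_depOn (depOn_corrPhiS hn hr α x) hS (corrPhiS_sum_smul (toSite r) n) A

/-- [folklore] **ROW-FINITENESS OF `Ψ̂_S`**: the field–field entry vanishes off the read set. -/
theorem psiKS_inl_inl_eq_zero {x y : Site (d + 1)} {α β : Fin (d + 1)} (h : (β, y) ∉ CorrReads n α x) :
    psiKS r n x y (Sum.inl α) (Sum.inl β) = 0 :=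
  apply_indR_eq_zero_of_not_mem (depOn_corrPsiS hn hr α x) (corrPsiS_zero (toSite r) n) h

/-- [folklore] **ROW-FINITENESS OF `Φ̂_S`.** -/
theorem phiKS_inl_inl_eq_zero {x y : Site (d + 1)} {α β : Fin (d + 1)} (h : (β, y) ∉ CorrReads n α x) :
    phiKS r n x y (Sum.inl α) (Sum.inl β) = 0 :=
  apply_indR_eq_zero_of_not_mem (depOn_corrPhiS hn hr α x) (corrPhiS_zero (toSite r) n) h

/-- [folklore] **FINITE RANGE `0` IN BLOCK UNITS**: if the `n`-block of `y` is neither the block of `x` nor the block of any `x + e_α`, then `Ψ̂_S (x,·) (y,·) = idK (x,·) (y,·)`. -/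
theorem psiKS_eq_idK_of_blk_ne {x y : Site (d + 1)} (h1 : blk n y ≠ blk n x) (h2 : ∀ α : Fin (d + 1), blk n y ≠ blk n (x + unitVec α)) (a b : Fib d) :
    psiKS r n x y a b = idK x y a b := by
  classical
  have hxy : x ≠ y := fun e => h1 (by rw [e])
  rcases a with α | μ <;> rcases b with β | μ'
  · rw [idK_apply, if_neg (fun h => hxy h.1)]
    refine psiKS_inl_inl_eq_zero hn hr fun hp => ?_
    rcases hp with hp | hp | hp
    · exact hxy (Prod.ext_iff.1 hp).2.symm
    · exact h1 hp.1
    · exact h2 α hp.1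
  · rw [psiKS_inl_inr, idK_apply, if_neg (fun h => hxy h.1)]
  · rw [psiKS_inr_inl, idK_apply, if_neg (fun h => hxy h.1)]
  · rw [psiKS_inr_inr, idK_apply]
    by_cases h : x = y ∧ μ = μ'
    · rw [if_pos h, if_pos ⟨h.1, congrArg Sum.inr h.2⟩]
    · rw [if_neg h, if_neg (fun h' => h ⟨h'.1, Sum.inr_injective h'.2⟩)]

/-- [folklore] **FINITE RANGE `0` IN BLOCK UNITS FOR `Φ̂_S`.** -/
theorem phiKS_eq_idK_of_blk_ne {x y : Site (d + 1)} (h1 : blk n y ≠ blk n x) (h2 : ∀ α : Fin (d + 1), blk n y ≠ blk n (x + unitVec α)) (a b : Fib d) :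
    phiKS r n x y a b = idK x y a b := by
  classical
  have hxy : x ≠ y := fun e => h1 (by rw [e])
  rcases a with α | μ <;> rcases b with β | μ'
  · rw [idK_apply, if_neg (fun h => hxy h.1)]
    refine phiKS_inl_inl_eq_zero hn hr fun hp => ?_
    rcases hp with hp | hp | hp
    · exact hxy (Prod.ext_iff.1 hp).2.symm
    · exact h1 hp.1
    · exact h2 α hp.1
  · rw [phiKS_inl_inr, idK_apply, if_neg (fun h => hxy h.1)]
  · rw [phiKS_inr_inl, idK_apply, if_neg (fun h => hxy h.1)]
  · rw [phiKS_inr_inr, idK_apply]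
    by_cases h : x = y ∧ μ = μ'
    · rw [if_pos h, if_pos ⟨h.1, congrArg Sum.inr h.2⟩]
    · rw [if_neg h, if_neg (fun h' => h ⟨h'.1, Sum.inr_injective h'.2⟩)]

/-- [folklore] **THE APPLY BRIDGE FOR `Ψ̂_S`, LEFT ACTION ON COLUMNS** — NO hypothesis on `K`:
`comp (psiKS r n) K x z (inl α) b = (Ψ_S (κ, y ↦ K y z (inl κ) b))_α(x)`. -/
theorem comp_psiKS_inl (K : MKer (d + 1) (Fib d)) (x z : Site (d + 1)) (α : Fin (d + 1)) (b : Fib d) :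
    comp (psiKS r n) K x z (Sum.inl α) b = corrPsiS (toSite r) n (fun κ y => K y z (Sum.inl κ) b) α x :=
  comp_kerOf_inl (depOn_corrPsiS hn hr) (corrPsiS_sum_smul (toSite r) n) (exists_finset_corrReadsS hn) K x z α b

omit hn hr in
/-- [folklore] `comp (psiKS r n) K x z (inr μ) b = K x z (inr μ) b`. -/
theorem comp_psiKS_inr (K : MKer (d + 1) (Fib d)) (x z : Site (d + 1)) (μ : Fin (d + 1)) (b : Fib d) :
    comp (psiKS r n) K x z (Sum.inr μ) b = K x z (Sum.inr μ) b :=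
  comp_kerOf_inr _ K x z μ b

/-- [folklore] **THE APPLY BRIDGE FOR `Ψ̂_S`, RIGHT ACTION ON ROWS** — NO hypothesis on `K`:
`comp K (trK (psiKS r n)) x z a (inl β) = (Ψ_S (κ, y ↦ K x y a (inl κ)))_β(z)`. -/
theorem comp_trK_psiKS_inl (K : MKer (d + 1) (Fib d)) (x z : Site (d + 1)) (a : Fib d) (β : Fin (d + 1)) :
    comp K (trK (psiKS r n)) x z a (Sum.inl β) = corrPsiS (toSite r) n (fun κ y => K x y a (Sum.inl κ)) β z :=
  comp_trK_kerOf_inl (depOn_corrPsiS hn hr) (corrPsiS_sum_smul (toSite r) n) (exists_finset_corrReadsS hn) K x z a β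

omit hn hr in
/-- [folklore] `comp K (trK (psiKS r n)) x z a (inr μ) = K x z a (inr μ)`. -/
theorem comp_trK_psiKS_inr (K : MKer (d + 1) (Fib d)) (x z : Site (d + 1)) (a : Fib d) (μ : Fin (d + 1)) :
    comp K (trK (psiKS r n)) x z a (Sum.inr μ) = K x z a (Sum.inr μ) :=
  comp_trK_kerOf_inr _ K x z a μ

/-- [folklore] **THE APPLY BRIDGE FOR `Φ̂_S`, LEFT ACTION ON COLUMNS** — NO hypothesis on `K`. -/
theorem comp_phiKS_inl (K : MKer (d + 1) (Fib d)) (x z : Site (d + 1)) (α : Fin (d + 1)) (b : Fib d) :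
    comp (phiKS r n) K x z (Sum.inl α) b = corrPhiS (toSite r) n (fun κ y => K y z (Sum.inl κ) b) α x :=
  comp_kerOf_inl (depOn_corrPhiS hn hr) (corrPhiS_sum_smul (toSite r) n) (exists_finset_corrReadsS hn) K x z α b

omit hn hr in
/-- [folklore] `comp (phiKS r n) K x z (inr μ) b = K x z (inr μ) b`. -/
theorem comp_phiKS_inr (K : MKer (d + 1) (Fib d)) (x z : Site (d + 1)) (μ : Fin (d + 1)) (b : Fib d) :
    comp (phiKS r n) K x z (Sum.inr μ) b = K x z (Sum.inr μ) b :=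
  comp_kerOf_inr _ K x z μ b

/-- [folklore] **THE APPLY BRIDGE FOR `Φ̂_S`, RIGHT ACTION ON ROWS** — NO hypothesis on `K`. -/
theorem comp_trK_phiKS_inl (K : MKer (d + 1) (Fib d)) (x z : Site (d + 1)) (a : Fib d) (β : Fin (d + 1)) :
    comp K (trK (phiKS r n)) x z a (Sum.inl β) = corrPhiS (toSite r) n (fun κ y => K x y a (Sum.inl κ)) β z :=
  comp_trK_kerOf_inl (depOn_corrPhiS hn hr) (corrPhiS_sum_smul (toSite r) n) (exists_finset_corrReadsS hn) K x z a β

omit hn hr in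
/-- [folklore] `comp K (trK (phiKS r n)) x z a (inr μ) = K x z a (inr μ)`. -/
theorem comp_trK_phiKS_inr (K : MKer (d + 1) (Fib d)) (x z : Site (d + 1)) (a : Fib d) (μ : Fin (d + 1)) :
    comp K (trK (phiKS r n)) x z a (Sum.inr μ) = K x z a (Sum.inr μ) :=
  comp_trK_kerOf_inr _ K x z a μ

end Bridge

/-! ## §3 Block-translation covariance; the kernel correctors are bounded and spread -/

section Spread

variable {n : ℕ} (hn : 0 < n) {r : Fin (d + 1) → ℕ} (hr : r ∈ box (d + 1) n)
include hn

/-- [folklore] **BLOCK-TRANSLATION COVARIANCE OF `Ψ̂_S`**: `Ψ̂_S (x + n v) (y + n v) = Ψ̂_S x y` (`corrPsiS_shift`). -/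
theorem psiKS_shift (x y v : Site (d + 1)) (a b : Fib d) : psiKS r n (x + (n : ℤ) • v) (y + (n : ℤ) • v) a b = psiKS r n x y a b :=
  kerOf_shift (fun A => corrPsiS_shift (toSite r) hn A v) x y a b

/-- [folklore] **BLOCK-TRANSLATION COVARIANCE OF `Φ̂_S`** (`corrPhiS_shift`). -/
theorem phiKS_shift (x y v : Site (d + 1)) (a b : Fib d) : phiKS r n (x + (n : ℤ) • v) (y + (n : ℤ) • v) a b = phiKS r n x y a b :=
  kerOf_shift (fun A => corrPhiS_shift (toSite r) hn A v) x y a b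

/-- [folklore] `shiftK (n • v) Ψ̂_S = Ψ̂_S`. -/
theorem shiftK_psiKS (v : Site (d + 1)) : shiftK ((n : ℤ) • v) (psiKS r n) = psiKS r n := by
  funext x y a b; exact psiKS_shift hn x y v a b

/-- [folklore] `shiftK (n • v) Φ̂_S = Φ̂_S`. -/
theorem shiftK_phiKS (v : Site (d + 1)) : shiftK ((n : ℤ) • v) (phiKS r n) = phiKS r n := by
  funext x y a b; exact phiKS_shift hn x y v a b

include hr

/-- [folklore] **`Ψ̂_S` DECAYS AT EVERY RATE** `δ ≥ 0` with constant `kerBound Ψ̂_S n · e^{δ·2(d+1)n}`. -/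
theorem decays_psiKS {δ : ℝ} (hδ : 0 ≤ δ) : Decays (psiKS r n) (kerBound (psiKS r n) n * Real.exp (δ * (2 * (((d : ℝ) + 1) * n)))) δ :=
  decays_of_blockShift_of_range hn (fun x y v a b => psiKS_shift hn x y v a b) (fun _ _ h1 h2 a b => psiKS_eq_idK_of_blk_ne hn hr h1 h2 a b) hδ

/-- [folklore] **`Φ̂_S` DECAYS AT EVERY RATE.** -/
theorem decays_phiKS {δ : ℝ} (hδ : 0 ≤ δ) : Decays (phiKS r n) (kerBound (phiKS r n) n * Real.exp (δ * (2 * (((d : ℝ) + 1) * n)))) δ :=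
  decays_of_blockShift_of_range hn (fun x y v a b => phiKS_shift hn x y v a b) (fun _ _ h1 h2 a b => phiKS_eq_idK_of_blk_ne hn hr h1 h2 a b) hδ

/-- [folklore] **`Spr (psiKS r n)`**. -/
theorem spr_psiKS : Spr (psiKS r n) := ⟨_, 1, one_pos, decays_psiKS hn hr zero_le_one⟩

/-- [folklore] **`Spr (phiKS r n)`**. -/
theorem spr_phiKS : Spr (phiKS r n) := ⟨_, 1, one_pos, decays_phiKS hn hr zero_le_one⟩

/-- [folklore] `Spr (trK (psiKS r n))`. -/
theorem spr_trK_psiKS : Spr (trK (psiKS r n)) := (spr_psiKS hn hr).trK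

/-- [folklore] `Spr (trK (phiKS r n))`. -/
theorem spr_trK_phiKS : Spr (trK (phiKS r n)) := (spr_phiKS hn hr).trK

end Spread

/-! ## §4 The kernel correctors are mutually inverse -/

section Inverse

variable {n : ℕ} (hn : 0 < n) {r : Fin (d + 1) → ℕ} (hr : r ∈ box (d + 1) n)
include hn hr

/-- [folklore] **`Ψ̂_S ∘ Φ̂_S = 1`** (apply bridge + the Form-level `corrPsiS_corrPhiS`). -/
theorem comp_psiKS_phiKS : comp (psiKS r n) (phiKS r n) = (idK : MKer (d + 1) (Fib d)) := by
  funext x z a b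
  rcases a with α | μ
  · rw [comp_psiKS_inl hn hr, idK_apply]
    rcases b with β | μ'
    · have hcol : (fun κ y => phiKS r n y z (Sum.inl κ) (Sum.inl β)) = corrPhiS (toSite r) n (indR β z) := by
        funext κ y; rw [phiKS_inl_inl]
      rw [hcol, corrPsiS_corrPhiS hr, indR_apply]
      by_cases h : x = z ∧ α = β
      · rw [if_pos ⟨h.2, h.1⟩, if_pos ⟨h.1, congrArg Sum.inl h.2⟩]
      · rw [if_neg (fun h' => h ⟨h'.2, h'.1⟩), if_neg (fun h' => h ⟨h'.1, Sum.inl_injective h'.2⟩)]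
    · have hcol : (fun κ y => phiKS r n y z (Sum.inl κ) (Sum.inr μ')) = 0 := by
        funext κ y; rw [phiKS_inl_inr]; rfl
      rw [hcol, corrPsiS_zero, if_neg (fun h => Sum.inl_ne_inr h.2)]; rfl
  · rw [comp_psiKS_inr, idK_apply]
    rcases b with β | μ'
    · rw [phiKS_inr_inl, if_neg (fun h => Sum.inr_ne_inl h.2)]
    · rw [phiKS_inr_inr]
      by_cases h : x = z ∧ μ = μ'
      · rw [if_pos h, if_pos ⟨h.1, congrArg Sum.inr h.2⟩]
      · rw [if_neg h, if_neg (fun h' => h ⟨h'.1, Sum.inr_injective h'.2⟩)]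

/-- [folklore] **`Φ̂_S ∘ Ψ̂_S = 1`**. -/
theorem comp_phiKS_psiKS : comp (phiKS r n) (psiKS r n) = (idK : MKer (d + 1) (Fib d)) := by
  funext x z a b
  rcases a with α | μ
  · rw [comp_phiKS_inl hn hr, idK_apply]
    rcases b with β | μ'
    · have hcol : (fun κ y => psiKS r n y z (Sum.inl κ) (Sum.inl β)) = corrPsiS (toSite r) n (indR β z) := by
        funext κ y; rw [psiKS_inl_inl]
      rw [hcol, corrPhiS_corrPsiS hr, indR_apply]
      by_cases h : x = z ∧ α = β
      · rw [if_pos ⟨h.2, h.1⟩, if_pos ⟨h.1, congrArg Sum.inl h.2⟩]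
      · rw [if_neg (fun h' => h ⟨h'.2, h'.1⟩), if_neg (fun h' => h ⟨h'.1, Sum.inl_injective h'.2⟩)]
    · have hcol : (fun κ y => psiKS r n y z (Sum.inl κ) (Sum.inr μ')) = 0 := by
        funext κ y; rw [psiKS_inl_inr]; rfl
      rw [hcol, corrPhiS_zero, if_neg (fun h => Sum.inl_ne_inr h.2)]; rfl
  · rw [comp_phiKS_inr, idK_apply]
    rcases b with β | μ'
    · rw [psiKS_inr_inl, if_neg (fun h => Sum.inr_ne_inl h.2)]
    · rw [psiKS_inr_inr]
      by_cases h : x = z ∧ μ = μ'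
      · rw [if_pos h, if_pos ⟨h.1, congrArg Sum.inr h.2⟩]
      · rw [if_neg h, if_neg (fun h' => h ⟨h'.1, Sum.inr_injective h'.2⟩)]

end Inverse

/-! ## §5 The kernel correctors preserve every rooted axial (comb) slice of the blocking -/

section Slice

variable (r : Fin (d + 1) → ℕ) (n : ℕ) {s : Fin (d + 1) → ℕ}

open Classical in
/-- [folklore] **SLICE RULE FOR `Ψ̂_S`**: `(axEc ∘ Ψ̂_S) ∘ axEc = Ψ̂_S ∘ axEc` for `axEc (toSite s) n`, ANY in-block slice root `s` — the field rows of `Ψ̂_S − 1` on comb bonds vanish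
(`corrPsiS_apply_of_blk_eq` on the intra-block conjunct of `IsCombBondAt`), the multiplier block is the identity. -/
theorem comp_comp_axEc_psiKS (hs : s ∈ box (d + 1) n) :
    comp (comp (axEc (toSite s) n) (psiKS r n)) (axEc (toSite s) n) = comp (psiKS r n) (axEc (toSite s) n) := by
  have _ := hs
  funext x z a b
  rw [comp_axEc_apply', comp_axEc_apply']
  rcases b with β | μ'
  · show (if IsCombBondAt (toSite s) n β z then 0 else comp (axEc (toSite s) n) (psiKS r n) x z a (Sum.inl β)) =
      if IsCombBondAt (toSite s) n β z then 0 else psiKS r n x z a (Sum.inl β)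
    by_cases hcz : IsCombBondAt (toSite s) n β z
    · rw [if_pos hcz, if_pos hcz]
    rw [if_neg hcz, if_neg hcz, comp_axEc_apply]
    rcases a with α | μ
    · show (if IsCombBondAt (toSite s) n α x then 0 else psiKS r n x z (Sum.inl α) (Sum.inl β)) = psiKS r n x z (Sum.inl α) (Sum.inl β)
      by_cases hcx : IsCombBondAt (toSite s) n α x
      · rw [if_pos hcx, psiKS_inl_inl, corrPsiS_apply_of_blk_eq (toSite r) n _ hcx.2, indR_apply]
        by_cases h : α = β ∧ x = z
        · obtain ⟨rfl, rfl⟩ := h; exact absurd hcx hcz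
        · rw [if_neg h]
      · rw [if_neg hcx]
    · show (if Torus.proj n x = 0 then psiKS r n x z (Sum.inr μ) (Sum.inl β) else 0) = psiKS r n x z (Sum.inr μ) (Sum.inl β)
      rw [psiKS_inr_inl]; split_ifs <;> rfl
  · show (if Torus.proj n z = 0 then comp (axEc (toSite s) n) (psiKS r n) x z a (Sum.inr μ') else 0) =
      if Torus.proj n z = 0 then psiKS r n x z a (Sum.inr μ') else 0
    by_cases hpz : Torus.proj n z = 0
    · rw [if_pos hpz, if_pos hpz, comp_axEc_apply]
      rcases a with α | μ
      · show (if IsCombBondAt (toSite s) n α x then 0 else psiKS r n x z (Sum.inl α) (Sum.inr μ')) = psiKS r n x z (Sum.inl α) (Sum.inr μ')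
        rw [psiKS_inl_inr]; split_ifs <;> rfl
      · show (if Torus.proj n x = 0 then psiKS r n x z (Sum.inr μ) (Sum.inr μ') else 0) = psiKS r n x z (Sum.inr μ) (Sum.inr μ')
        by_cases hpx : Torus.proj n x = 0
        · rw [if_pos hpx]
        · rw [if_neg hpx, psiKS_inr_inr, if_neg]
          rintro ⟨rfl, -⟩
          exact hpx hpz
    · rw [if_neg hpz, if_neg hpz]

open Classical in
/-- [folklore] **SLICE RULE FOR `Φ̂_S`**: `(axEc ∘ Φ̂_S) ∘ axEc = Φ̂_S ∘ axEc`. -/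
theorem comp_comp_axEc_phiKS (hs : s ∈ box (d + 1) n) :
    comp (comp (axEc (toSite s) n) (phiKS r n)) (axEc (toSite s) n) = comp (phiKS r n) (axEc (toSite s) n) := by
  have _ := hs
  funext x z a b
  rw [comp_axEc_apply', comp_axEc_apply']
  rcases b with β | μ'
  · show (if IsCombBondAt (toSite s) n β z then 0 else comp (axEc (toSite s) n) (phiKS r n) x z a (Sum.inl β)) =
      if IsCombBondAt (toSite s) n β z then 0 else phiKS r n x z a (Sum.inl β)
    by_cases hcz : IsCombBondAt (toSite s) n β z
    · rw [if_pos hcz, if_pos hcz]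
    rw [if_neg hcz, if_neg hcz, comp_axEc_apply]
    rcases a with α | μ
    · show (if IsCombBondAt (toSite s) n α x then 0 else phiKS r n x z (Sum.inl α) (Sum.inl β)) = phiKS r n x z (Sum.inl α) (Sum.inl β)
      by_cases hcx : IsCombBondAt (toSite s) n α x
      · rw [if_pos hcx, phiKS_inl_inl, corrPhiS_apply_of_blk_eq (toSite r) n _ hcx.2, indR_apply]
        by_cases h : α = β ∧ x = z
        · obtain ⟨rfl, rfl⟩ := h; exact absurd hcx hcz
        · rw [if_neg h]
      · rw [if_neg hcx]
    · show (if Torus.proj n x = 0 then phiKS r n x z (Sum.inr μ) (Sum.inl β) else 0) = phiKS r n x z (Sum.inr μ) (Sum.inl β)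
      rw [phiKS_inr_inl]; split_ifs <;> rfl
  · show (if Torus.proj n z = 0 then comp (axEc (toSite s) n) (phiKS r n) x z a (Sum.inr μ') else 0) =
      if Torus.proj n z = 0 then phiKS r n x z a (Sum.inr μ') else 0
    by_cases hpz : Torus.proj n z = 0
    · rw [if_pos hpz, if_pos hpz, comp_axEc_apply]
      rcases a with α | μ
      · show (if IsCombBondAt (toSite s) n α x then 0 else phiKS r n x z (Sum.inl α) (Sum.inr μ')) = phiKS r n x z (Sum.inl α) (Sum.inr μ')
        rw [phiKS_inl_inr]; split_ifs <;> rfl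
      · show (if Torus.proj n x = 0 then phiKS r n x z (Sum.inr μ) (Sum.inr μ') else 0) = phiKS r n x z (Sum.inr μ) (Sum.inr μ')
        by_cases hpx : Torus.proj n x = 0
        · rw [if_pos hpx]
        · rw [if_neg hpx, phiKS_inr_inr, if_neg]
          rintro ⟨rfl, -⟩
          exact hpx hpz
    · rw [if_neg hpz, if_neg hpz]

end Slice

end

end Summit.QuantumFields.BalabanUV.Beta.SymCorrectorKernel
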